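import Literature.Computability.Cryptography.UnitResidueGiant
import HarnessLib

/-!
# The unit-residue algorithm, III: reduction runs and guarded walks

Topic `Computability/Cryptography`, continuing `UnitResidueSteps.lean` / `UnitResidueGiant.lean`.
Two iterations of the moves analysed there:

* **`GoodI.reduceF`** — running the reduction rounds from a state with the frame invariant and
  `a < Δ` for `n ≥ L + 1` rounds (`4ᴸ > a`) yields a GOOD (reduced) state; `|θ|` changes by a factor
  in `[1/(2Δa), 1]` and the accuracy degrades by at most `5n/2^P` (Jacobson–Williams §5.2 with the
  distance correction (5.12); every round is charged whether or not it steps);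
* **guarded walks** `gwalk tgt n = (gstep tgt)ⁿ`, `gstep tgt s = if ⌊log₂⌋-reading < tgt then ρ(s)`:
  `iterate_guard` (a guarded iteration is the plain iteration stopped at the first index where the
  guard fails), `Good.gwalk_spec` (good states stay good, accuracy `+ 5n/2^P`, `θ` keeps its sign and grows),
  and the window lemma `Good.gwalk_window`: if the plain baby-step walk from `s` needs `J ≤ n` steps to
  bring the reading to `≥ tgt`, then the walk takes exactly `J` steps and ends with
  `tgt - 1/8 ≤ log₂|θ| ≤ max (log₂|θ₀|) (tgt + 1/8 + log₂ √Δ)`; `Good.exists_stop` produces such a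
  `J ≤ 2D + 2` whenever `log₂|θ₀| ≥ tgt - D` (the distance at least doubles every two baby steps,
  `Inv.pow_mul_theta_le`).

Everything is proved; no named facts.

## References

* M. J. Jacobson, Jr., H. C. Williams, *Solving the Pell Equation*, CMS Books in Mathematics, Springer
  (2009), §5.2, (5.12), §7.4 ("compute a reduced principal ideal with distance close to a given
  quantity"), §12.1 (Alg. 12.1 EWNEAR). [JacobsonWilliams2008]
-/

noncomputable section

open scoped Classical

namespace Literature.Computability.Cryptography.UnitResidue

open Literature.NumberTheory.QuadraticFields.Infra

variable {pm : Prm}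

/-! ### Reduction runs -/

/-- The sign and float of `reduceF` at round `0`. [folklore] -/
theorem reduceF_zero (s : AS) : reduceF pm s 0 = ⟨normalize pm.Δ s.fr, s.sgn, s.M, s.E⟩ := rfl

/-- Along the reduction the norm stays below `Δ`. [folklore] -/
theorem Prm.OK.reduceF_a_lt (h : pm.OK) {s : AS} (hI : Inv pm.Δ s.fr) (haΔ : (s.fr.a : ℤ) < pm.Δ) (k : ℕ) :
    ((reduceF pm s k).fr.a : ℤ) < pm.Δ := by
  have J := redInv_reduceF h hI k
  by_cases hbig : (Nat.sqrt pm.Δ : ℤ) < (reduceF pm s k).fr.a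
  · obtain ⟨_, hpow⟩ := J.big hbig
    have h1 : (reduceF pm s k).fr.a ≤ s.fr.a :=
      le_trans (Nat.le_mul_of_pos_right _ (Nat.one_le_pow _ _ (by norm_num))) hpow
    omega
  · push Not at hbig
    have := nat_sqrt_sq_lt h.disc
    nlinarith

/-- **A reduction run**: invariant states along the rounds, accuracy `ε + 5k/2^P`. [cite: JacobsonWilliams2008, §5.2] -/
theorem GoodI.reduceF_goodI (h : pm.OK) {s : AS} {ε : ℝ} (hg : GoodI pm s ε) (haΔ : (s.fr.a : ℤ) < pm.Δ)
    (k : ℕ) : GoodI pm (reduceF pm s k) (ε + k * (5 / (2 : ℝ) ^ pm.P)) := by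
  induction k with
  | zero =>
    rw [reduceF_zero]
    simp only [Nat.cast_zero, zero_mul, add_zero]
    exact ⟨hg.inv.normalize, hg.sgn, by rw [normalize_p]; exact hg.pos, by rw [normalize_p]; exact hg.acc⟩
  | succ k ih =>
    rw [reduceF_succ]
    have hN : Norm pm.Δ (reduceF pm s k).fr := (redInv_reduceF h hg.inv k).norm
    have := ih.rstepF_spec h hN (h.reduceF_a_lt hg.inv haΔ k)
    push_cast
    refine ⟨this.inv, this.sgn, this.pos, this.acc.mono (le_of_eq (by ring))⟩

/-- **A complete reduction run**: after `n ≥ L + 1` rounds (`4ᴸ > a`) the state is good (reduced),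
`|θ|` changed by a factor in `[1/(2Δa), 1]`, accuracy `ε + 5n/2^P`. [cite: JacobsonWilliams2008, §5.2, (5.12)] -/
theorem GoodI.reduceF_spec (h : pm.OK) {s : AS} {ε : ℝ} (hg : GoodI pm s ε) (haΔ : (s.fr.a : ℤ) < pm.Δ)
    {L n : ℕ} (hL : s.fr.a < 4 ^ L) (hn : L + 1 ≤ n) :
    Good pm (reduceF pm s n) (ε + n * (5 / (2 : ℝ) ^ pm.P)) ∧
      |ev pm.Δ (rt pm.Δ) (UnitResidue.reduceF pm s n).fr.p| ≤ |ev pm.Δ (rt pm.Δ) s.fr.p| ∧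
      |ev pm.Δ (rt pm.Δ) s.fr.p| ≤ 2 * pm.Δ * s.fr.a * |ev pm.Δ (rt pm.Δ) (UnitResidue.reduceF pm s n).fr.p| := by
  have hGI := hg.reduceF_goodI h haΔ n
  obtain ⟨_, hR, hle, hge⟩ := hg.inv.reduce_spec h.disc hL hn
  rw [← reduceF_fr] at hR hle hge
  exact ⟨⟨hGI, hR⟩, hle, hge⟩

/-! ### Guarded iteration -/

/-- **A guarded iteration is the plain iteration stopped where the guard first fails.** [folklore] -/
theorem iterate_guard {α : Type} (f : α → α) (P : α → Prop) [DecidablePred P] (x : α) {J : ℕ}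
    (hJ : ¬ P (f^[J] x)) (hbefore : ∀ j, j < J → P (f^[j] x)) (n : ℕ) :
    (fun y => if P y then f y else y)^[n] x = f^[min n J] x := by
  induction n with
  | zero => simp
  | succ n ih =>
    rw [Function.iterate_succ_apply', ih]
    by_cases hn : n < J
    · rw [min_eq_left hn.le, if_pos (hbefore n hn), min_eq_left (by omega), Function.iterate_succ_apply']
    · push Not at hn
      rw [min_eq_right hn, if_neg hJ, min_eq_right (by omega)]

/-! ### Walks -/

/-- The integer reading `E + P = ⌊log₂ val⌋` of the float of a state. [cite: JacobsonWilliams2008, §11.1 (k)] -/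
def ilog (pm : Prm) (s : AS) : ℤ := s.E + pm.P

/-- One guarded baby step: step while the reading is below the target. [cite: JacobsonWilliams2008, §12.1 (Alg. 12.1)] -/
def gstep (pm : Prm) (tgt : ℤ) (s : AS) : AS := if ilog pm s < tgt then bstepF pm s else s

/-- The guarded walk of `n` rounds. [cite: JacobsonWilliams2008, §7.4, §12.1] -/
def gwalk (pm : Prm) (tgt : ℤ) (n : ℕ) (s : AS) : AS := (gstep pm tgt)^[n] s

/-- The frame after `j` plain baby steps is `Infra.walk`. [folklore] -/
theorem bstepF_iterate_fr (s : AS) (j : ℕ) : ((bstepF pm)^[j] s).fr = walk pm.Δ s.fr j := by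
  induction j with
  | zero => rfl
  | succ j ih => rw [Function.iterate_succ_apply', walk_succ, ← ih]; rfl

/-- The sign is unchanged by plain baby steps. [folklore] -/
theorem bstepF_iterate_sgn (s : AS) (j : ℕ) : ((bstepF pm)^[j] s).sgn = s.sgn := by
  induction j with
  | zero => rfl
  | succ j ih => rw [Function.iterate_succ_apply']; exact ih

/-- **Plain baby steps keep good states good**, accuracy `ε + 5j/2^P`. [cite: JacobsonWilliams2008, §12.1] -/
theorem Good.bstepF_iterate (h : pm.OK) {s : AS} {ε : ℝ} (hg : Good pm s ε) (j : ℕ) :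
    Good pm ((bstepF pm)^[j] s) (ε + j * (5 / (2 : ℝ) ^ pm.P)) := by
  induction j with
  | zero => simpa using hg
  | succ j ih =>
    rw [Function.iterate_succ_apply']
    have := (ih.bstepF_spec h).1
    push_cast
    exact ⟨⟨this.inv, this.sgn, this.pos, this.acc.mono (le_of_eq (by ring))⟩, this.red⟩

/-- The walk is the plain iteration stopped at the first index with reading `≥ tgt`. [folklore] -/
theorem gwalk_eq_iterate {tgt : ℤ} {s : AS} {J : ℕ} (hJ : tgt ≤ ilog pm ((bstepF pm)^[J] s))
    (hbefore : ∀ j, j < J → ilog pm ((bstepF pm)^[j] s) < tgt) (n : ℕ) :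
    gwalk pm tgt n s = (bstepF pm)^[min n J] s := by
  unfold gwalk gstep
  exact iterate_guard (bstepF pm) (fun y => ilog pm y < tgt) s (by simpa using hJ) hbefore n

/-- `log₂ |θ|` after `j` plain baby steps is at least `log₂ |θ₀| + ⌊j/2⌋`… in the form
`2^k |θ₀| ≤ |θ_{2k}|`. [cite: JacobsonWilliams2008, §5.3 Thm. 5.18 (proof)] -/
theorem Good.pow_mul_abs_le (h : pm.OK) {s : AS} {ε : ℝ} (hg : Good pm s ε) (k : ℕ) :
    (2 : ℝ) ^ k * |ev pm.Δ (rt pm.Δ) s.fr.p| ≤ |ev pm.Δ (rt pm.Δ) ((bstepF pm)^[2 * k] s).fr.p| := by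
  have := hg.inv.pow_mul_theta_le h.disc hg.red k
  unfold theta at this
  rw [bstepF_iterate_fr]
  simpa using this

/-- **Log reading of a good state**: `ilog - ε ≤ log₂|θ| < ilog + 1 + ε`. [cite: JacobsonWilliams2008, §11.1] -/
theorem GoodI.logb_bounds {s : AS} {ε : ℝ} (hg : GoodI pm s ε) :
    (ilog pm s : ℝ) - ε ≤ Real.logb 2 |ev pm.Δ (rt pm.Δ) s.fr.p| ∧
      Real.logb 2 |ev pm.Δ (rt pm.Δ) s.fr.p| < (ilog pm s : ℝ) + 1 + ε := by
  have := hg.acc.logb_bounds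
  unfold ilog
  push_cast at this ⊢
  constructor <;> linarith [this.1, this.2]

/-- `log₂` of one baby-step factor: `0 < log₂ ψ < log₂ √Δ`. [cite: JacobsonWilliams2008, §5.1 Cor. 5.8.1] -/
theorem Good.logb_psi (h : pm.OK) {s : AS} {ε : ℝ} (hg : Good pm s ε) :
    0 < Real.logb 2 (s.fr.psi (rt pm.Δ)) ∧ Real.logb 2 (s.fr.psi (rt pm.Δ)) < Real.logb 2 (rt pm.Δ) := by
  obtain ⟨hψ1, _, _⟩ := hg.red.psi_bounds hg.inv.1
  have hψs : s.fr.psi (rt pm.Δ) < rt pm.Δ := by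
    have ha1 : (1 : ℝ) ≤ s.fr.a := by exact_mod_cast hg.inv.1
    have hs := rt_pos h.disc
    unfold St.psi
    rw [div_lt_iff₀ (by linarith)]
    nlinarith [hg.red.2]
  exact ⟨Real.logb_pos (by norm_num) hψ1, Real.logb_lt_logb (by norm_num) (by linarith) hψs⟩

/-- **Existence of the stopping index**: if `log₂|θ₀| ≥ tgt - D` then some `J ≤ 2D + 2` plain baby
steps bring the reading to `≥ tgt`, all earlier readings being `< tgt`, provided the accuracy stays
`≤ 1/8` for `2D + 2` steps. [cite: JacobsonWilliams2008, §7.4] -/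
theorem Good.exists_stop (h : pm.OK) {s : AS} {ε : ℝ} (hg : Good pm s ε) {tgt : ℤ} {D : ℕ}
    (hD : (tgt : ℝ) - D ≤ Real.logb 2 |ev pm.Δ (rt pm.Δ) s.fr.p|)
    (hε : ε + ((2 * D + 2 : ℕ) : ℝ) * (5 / (2 : ℝ) ^ pm.P) ≤ 1 / 8) :
    ∃ J : ℕ, J ≤ 2 * D + 2 ∧ tgt ≤ ilog pm ((bstepF pm)^[J] s) ∧
      ∀ j, j < J → ilog pm ((bstepF pm)^[j] s) < tgt := by
  have hkey : tgt ≤ ilog pm ((bstepF pm)^[2 * D + 2] s) := by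
    have hgJ := hg.bstepF_iterate h (2 * D + 2)
    have hgrow := hg.pow_mul_abs_le h (D + 1)
    rw [show 2 * (D + 1) = 2 * D + 2 by ring] at hgrow
    have hθ : 0 < |ev pm.Δ (rt pm.Δ) s.fr.p| := abs_pos.mpr (hg.inv.ev_p_ne_zero h.disc)
    have hlog : Real.logb 2 |ev pm.Δ (rt pm.Δ) s.fr.p| + ((D + 1 : ℕ) : ℝ) ≤
        Real.logb 2 |ev pm.Δ (rt pm.Δ) ((bstepF pm)^[2 * D + 2] s).fr.p| := by
      have := Real.logb_le_logb_of_le (b := 2) (by norm_num) (by positivity) hgrow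
      rw [Real.logb_mul (by positivity) hθ.ne', Real.logb_pow, Real.logb_self_eq_one (by norm_num)] at this
      push_cast at this ⊢
      linarith
    have hb := (hgJ.logb_bounds).2
    by_contra hlt
    push Not at hlt
    have : (ilog pm ((bstepF pm)^[2 * D + 2] s) : ℝ) + 1 ≤ tgt := by exact_mod_cast hlt
    push_cast at hlog hD hε hb
    linarith
  have hex : ∃ n, tgt ≤ ilog pm ((bstepF pm)^[n] s) := ⟨_, hkey⟩
  refine ⟨Nat.find hex, Nat.find_min' hex hkey, Nat.find_spec hex, fun j hj => ?_⟩
  have := Nat.find_min hex hj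
  push Not at this
  exact this

/-- `|θ|` only grows along plain baby steps. [folklore] -/
theorem Good.abs_le_iterate (h : pm.OK) {s : AS} {ε : ℝ} (hg : Good pm s ε) (j : ℕ) :
    |ev pm.Δ (rt pm.Δ) s.fr.p| ≤ |ev pm.Δ (rt pm.Δ) ((bstepF pm)^[j] s).fr.p| := by
  have := hg.inv.theta_mono h.disc hg.red (Nat.zero_le j)
  unfold theta at this
  rw [bstepF_iterate_fr]
  simpa using this

/-- **The window lemma for guarded walks**: from a good state with `log₂|θ| ≥ tgt - D`, fuel
`n ≥ 2D + 2` and accuracy budget `ε + 5n/2^P ≤ 1/8`, the walk ends good with the same sign,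
`tgt - 1/8 ≤ log₂|θ'|`, `log₂|θ'| ≤ max (log₂|θ|) (tgt + 1/8 + log₂ √Δ)` and `|θ| ≤ |θ'|`.
[cite: JacobsonWilliams2008, §7.4 (a reduced ideal with distance close to a given quantity), §12.1] -/
theorem Good.gwalk_window (h : pm.OK) {s : AS} {ε : ℝ} (hg : Good pm s ε) {tgt : ℤ} {D n : ℕ}
    (hD : (tgt : ℝ) - D ≤ Real.logb 2 |ev pm.Δ (rt pm.Δ) s.fr.p|) (hn : 2 * D + 2 ≤ n)
    (hε : ε + n * (5 / (2 : ℝ) ^ pm.P) ≤ 1 / 8) :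
    Good pm (gwalk pm tgt n s) (ε + n * (5 / (2 : ℝ) ^ pm.P)) ∧ (gwalk pm tgt n s).sgn = s.sgn ∧
      (tgt : ℝ) - 1 / 8 ≤ Real.logb 2 |ev pm.Δ (rt pm.Δ) (gwalk pm tgt n s).fr.p| ∧
      Real.logb 2 |ev pm.Δ (rt pm.Δ) (gwalk pm tgt n s).fr.p| ≤
        max (Real.logb 2 |ev pm.Δ (rt pm.Δ) s.fr.p|) ((tgt : ℝ) + 1 / 8 + Real.logb 2 (rt pm.Δ)) ∧
      |ev pm.Δ (rt pm.Δ) s.fr.p| ≤ |ev pm.Δ (rt pm.Δ) (gwalk pm tgt n s).fr.p| := by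
  have hP : (0 : ℝ) ≤ 5 / (2 : ℝ) ^ pm.P := by positivity
  have hε' : ε + ((2 * D + 2 : ℕ) : ℝ) * (5 / (2 : ℝ) ^ pm.P) ≤ 1 / 8 := by
    have : ((2 * D + 2 : ℕ) : ℝ) ≤ n := by exact_mod_cast hn
    nlinarith
  obtain ⟨J, hJle, hJ, hbefore⟩ := hg.exists_stop h hD hε'
  have hJn : J ≤ n := by omega
  have heq : gwalk pm tgt n s = (bstepF pm)^[J] s := by rw [gwalk_eq_iterate hJ hbefore n, min_eq_right hJn]
  rw [heq]
  have hgJ := hg.bstepF_iterate h J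
  have hεJ : ε + J * (5 / (2 : ℝ) ^ pm.P) ≤ ε + n * (5 / (2 : ℝ) ^ pm.P) := by
    have : (J : ℝ) ≤ n := by exact_mod_cast hJn
    nlinarith
  refine ⟨⟨⟨hgJ.inv, hgJ.sgn, hgJ.pos, hgJ.acc.mono hεJ⟩, hgJ.red⟩, bstepF_iterate_sgn s J, ?_, ?_,
    hg.abs_le_iterate h J⟩
  · have hb := (hgJ.logb_bounds).1
    have : (tgt : ℝ) ≤ ilog pm ((bstepF pm)^[J] s) := by exact_mod_cast hJ
    have hεJ' : ε + J * (5 / (2 : ℝ) ^ pm.P) ≤ 1 / 8 := hεJ.trans hε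
    linarith
  · rcases Nat.eq_zero_or_pos J with hJ0 | hJpos
    · subst hJ0; exact le_max_left _ _
    · obtain ⟨J', rfl⟩ : ∃ J', J = J' + 1 := ⟨J - 1, by omega⟩
      apply le_max_of_le_right
      have hlt := hbefore J' (by omega)
      have hgJ' := hg.bstepF_iterate h J'
      obtain ⟨_, hev, _⟩ := hgJ'.bstepF_spec h
      have hb := (hgJ'.logb_bounds).2
      obtain ⟨hψ0, hψs⟩ := hgJ'.logb_psi h
      have hθ : 0 < |ev pm.Δ (rt pm.Δ) ((bstepF pm)^[J'] s).fr.p| := abs_pos.mpr (hgJ'.inv.ev_p_ne_zero h.disc)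
      obtain ⟨hψ1, _, _⟩ := hgJ'.red.psi_bounds hgJ'.inv.1
      rw [Function.iterate_succ_apply', hev, abs_mul,
        abs_of_pos (by linarith : (0:ℝ) < ((bstepF pm)^[J'] s).fr.psi (rt pm.Δ)),
        Real.logb_mul hθ.ne' (by linarith)]
      have : (ilog pm ((bstepF pm)^[J'] s) : ℝ) + 1 ≤ tgt := by exact_mod_cast hlt
      have hεJ' : ε + (J' : ℕ) * (5 / (2 : ℝ) ^ pm.P) ≤ 1 / 8 := by
        have : ((J' : ℕ) : ℝ) ≤ n := by exact_mod_cast (show J' ≤ n by omega)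
        nlinarith
      linarith

end Literature.Computability.Cryptography.UnitResidue

end
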